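import Summits.CriticalPhenomena.PercolationContinuityZ3.Theorems.Transplant.SkelFrmQuasiProxHoldsAll
import Summits.CriticalPhenomena.PercolationContinuityZ3.Theorems.Transplant.AutCylinderAssembly
import Literature.GroupTheory.Nilpotent.PolynomialGrowthVirtuallyNilpotent
import HarnessLib

/-!
# Class C2 without the growth hypothesis: `θ(p_c) = 0` on every Cayley graph with `p_c < 1` of every finitely generated
# VIRTUALLY NILPOTENT group (Wolf's theorem supplies the polynomial growth bound)

builds on p205010 (kernel theorem, internal audit signed; external expert review pending).  Lane `prim-bschramm`, seat
`prim-bschramm-p3` gen 31 (class C2 owner); helper file (`--supports stmt-CriticalPhenomena-4575 --as helper`).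

THE POINT.  The rung-Q node `Transplant.frmQuasiNode` («SkelFrmQuasiProxHoldsAll», p553137) fed to
`AutCyl.conj4_cayley_virtuallyNilpotent_of_frmQuasiNode` («AutCylinderAssembly») gives `θ_g(p_c) = 0` on every Cayley graph
`Cay(Γ;S)` with `p_c < 1` of a group `Γ` with a nilpotent subgroup `N` of finite index — UNDER A POLYNOMIAL-GROWTH HYPOTHESIS
`hpoly : ∃ C D, |B(g,n)| ≤ C (n+1)^D` (the growth-degree induction of «AutCylinderNilpotent» runs on it).  That hypothesis is a
THEOREM: Wolf 1968 (every finitely generated virtually nilpotent group has polynomial growth), now in the tree as the Literature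
reproduction `Literature.GroupTheory.Nilpotent.exists_ballVolume_mulCayley_le_rpow` («PolynomialGrowthVirtuallyNilpotent», with
«PolynomialGrowthCollection» / «PolynomialGrowthNilpotent»: commutator collection, bounded generation with polynomial exponents,
transversal rewriting).  This file discharges it: **`AutCyl.conj4_cayley_virtuallyNilpotent`** — hypotheses: `S` finite generating,
`N ≤ Γ` nilpotent of finite index, `p_c < 1`; NO growth hypothesis, NO named fact — and the form over Mathlib's `Group.IsVirtuallyNilpotent`.
With Gromov's theorem (CITED, not typed: polynomial growth ⟹ virtually nilpotent) this is Benjamini–Schramm's Conjecture 4 on every Cayley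
graph of polynomial growth.  Nothing here edits or restates a `@[conjecture]`; nothing is claimed about `BenjaminiSchramm1996_conj4_endState`,
general quasi-transitive graphs of polynomial growth (those stay modulo `Trofimov1985_polynomialGrowthBlocks`) or general transitive graphs.
[cite: BenjaminiSchramm1996, Conj. 4; §2 (Cayley graphs)] [cite: WolfGrowth1968, Thm. 3.2] [cite: MilnorSolvableGrowth1968, Lemma 1]
[cite: KozmaNitzan2024, §4 Theorem 6]
-/

noncomputable section

namespace Summit.CriticalPhenomena.PercolationContinuityZ3.Theorems

namespace Transplant

namespace AutCyl

open SimpleGraph Literature.Barriers.CriticalPhenomena Literature.Probability.LatticeModels Literature.Probability.Percolation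
open scoped Classical

/-- **Benjamini–Schramm's Conjecture 4 for every Cayley graph of every finitely generated VIRTUALLY NILPOTENT group — no growth
hypothesis, no named fact**: for a group `Γ` with a nilpotent subgroup `N` of finite index and a finite generating set `S`, at every
vertex `g` of `Cay(Γ; S)` with `p_c < 1` one has `θ_g(p_c) = 0`.  The rung-Q node `frmQuasiNode` through
`conj4_cayley_virtuallyNilpotent_of_frmQuasiNode`, its growth hypothesis supplied by Wolf's theorem
`Literature.GroupTheory.Nilpotent.exists_ballVolume_mulCayley_le_rpow`.
builds on p205010 (kernel theorem, internal audit signed; external expert review pending).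
[cite: BenjaminiSchramm1996, Conj. 4; §2 (Cayley graphs)] [cite: WolfGrowth1968, Thm. 3.2] -/
theorem conj4_cayley_virtuallyNilpotent {Γ : Type} [Group Γ] (S : Finset Γ) (hS : Subgroup.closure (S : Set Γ) = ⊤)
    (N : Subgroup Γ) [N.FiniteIndex] [Group.IsNilpotent N] (g : Γ) (hpc : criticalProb (mulCayley (↑S : Set Γ)) g < 1) :
    theta (mulCayley (↑S : Set Γ)) g (criticalProbIOf (mulCayley (↑S : Set Γ)) g) = 0 :=
  conj4_cayley_virtuallyNilpotent_of_frmQuasiNode frmQuasiNode S hS N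
    (Literature.GroupTheory.Nilpotent.exists_ballVolume_mulCayley_le_rpow S hS N) g hpc

/-- **The same over Mathlib's predicate `Group.IsVirtuallyNilpotent Γ`** (`∃ N ≤ Γ` nilpotent of finite index): every Cayley graph
`Cay(Γ; S)` (`S` a finite generating set) of a virtually nilpotent group has `θ_g(p_c) = 0` at every vertex with `p_c < 1`.
builds on p205010 (kernel theorem, internal audit signed; external expert review pending).
[cite: BenjaminiSchramm1996, Conj. 4; §2 (Cayley graphs)] [cite: WolfGrowth1968, Thm. 3.2] -/
theorem conj4_cayley_of_isVirtuallyNilpotent {Γ : Type} [Group Γ] (hΓ : Group.IsVirtuallyNilpotent Γ) (S : Finset Γ)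
    (hS : Subgroup.closure (S : Set Γ) = ⊤) (g : Γ) (hpc : criticalProb (mulCayley (↑S : Set Γ)) g < 1) :
    theta (mulCayley (↑S : Set Γ)) g (criticalProbIOf (mulCayley (↑S : Set Γ)) g) = 0 := by
  obtain ⟨N, hN, hfi⟩ := hΓ
  haveI := hN
  haveI := hfi
  exact conj4_cayley_virtuallyNilpotent S hS N g hpc

end AutCyl

end Transplant

end Summit.CriticalPhenomena.PercolationContinuityZ3.Theorems

end
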